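import Summits.QuantumFields.YangMills.Theorems.BalabanUVNodesN21AtSRec13Weight
import Summits.QuantumFields.YangMills.Theorems.BalabanUVNodesN21SelectedThresholdsHistories
import Summits.QuantumFields.YangMills.Theorems.BalabanUVNodesN21SelectedThresholdsTransportLedgers

/-!
# YM-DAG node N21 (= NE7c) — THE ₁₃ K5 FACES OF THE SELECTION ROAD, IN ITS THREE CURRENCIES: at every admissible Stage-13 tuple the carriers of a spine reading
# that ARE a selected-threshold object (SHARP letters ∕ TRANSPORTED masses ∕ HISTORY letters, read at one admissible assignment with its certificate) carry road I's
# `ShellWeightBound (cr F θ hP g₀ os) … (C·ϑ^K)`, hence SOME re-weighting of `cr` carries `S_N21 (SRec₁₃ ·)` (the ₁₃ twin of module 19 + the ₁₃ faces of modules 20∕20c)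

Track A of `YM-PLAN.md` (cell `pub-ymgap`, HUMAN RULING D-0062), node **N21**; R134 fan-out seat `pub-ymgap-dag-n21-d` (s2), generation 5, module 21b.  THEOREMS ONLY:
0 `def`, 0 `sorry`, standard axioms; COUNT-NEUTRAL; `--supports` the K3‴ item `SpineGivenEndpointR13` (stmt-QuantumFields-19912) as a helper.  `N`-generic, NO Theses
import (restate-immune).  Imports module 21a `BalabanUVNodesN21AtSRec13Weight` (`exists_reweight_s_N21_sRec₁₃`; brings dag-n20-d's ₁₃ home `SRec₁₃`), module 20
`BalabanUVNodesN21SelectedThresholdsHistories` (p491967: `levelLedger_histories_of_goodAssignment`) and module 20c `BalabanUVNodesN21SelectedThresholdsTransportLedgers`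
(`lossPair_of_ne`; brings 18b `levelLedger_of_goodAssignment` ∕ `levelConst_le` and 20b `pushes_of_sandwich`).

THE POINT.  Plan g66's `K3Skeleton13.lean` reads N21 as `KeyedShellWeight cr` = «`ShellWeightBound` at `cr F θ hP g₀ os` for every admissible Stage-13 tuple» =
`S_N21 (SRec₁₃ cr)` (dag-n20-d `s_N21_sRec₁₃_iff`).  On the selection road the reading `cr` NODE O will type is print's threshold-parametric object READ AT the
admissible assignment 18b's `exists_goodAssignment` selects (one threshold per (comparison, level), shared by both runs); this file states, per currency, what such a
reading hands N21 and concludes the weight-free form `∃ ϑ C, 0 < ϑ < 1 ∧ 0 ≤ C ∧ ShellWeightBound (cr …) … (K ↦ C·ϑ^K)` at every admissible tuple: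
* §1 SHARP abstract letters (module 19's twin): both `LevelLedger`s AND the bound — 18b's `levelLedger_of_goodAssignment` ×2 + n21-a's `n21_knit_levels_geometric`;
* §2 TRANSPORTED masses (lens ROW A‴, module 20c's package at the selected assignment): pushes from `pushes_of_sandwich` (`M₁ = C.toReal`, `M₂ = C⁻¹.toReal`);
* §3 HISTORY letters (module 20's package at the selected assignment): (R) and pushes from the `pub-balaban` leaf, envelopes displayed;
* §4 in each currency SOME re-weighting `w` of `cr` carries `S_N21 (SRec₁₃ (re-weighted cr))` (21a §3) — and re-weighting is invisible to N20 ∕ N27x ∕ N19 (21a §2),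
  so the K3‴ composite reads the re-weighted reading with the other slots' certificates unchanged.

HONEST FRAMING (binding).  Keyed bookkeeping; `cr` is a PARAMETER — no reading of Bałaban's two-run expansion is typed; every package (`hsel` ∕ `htr` ∕ `hhist`) is a
HYPOTHESIS displaying NODE O's term object (sharp letters with (R) + pushes ∕ lineage data with sandwich + transported masses ∕ history weights with envelopes + mass
control + closeness), the selection certificate (18b supplies it to whoever builds the reading), N20's window, the admissible box, N16's rate; no inhabitant of
`Node00.IsRecordOfRecord₁₃C` claimed (K0‴ open); (M1) for print's FIXED thresholds untouched; nothing of Bałaban's asserted; NE7c NOT PRINTED and NOT PROVED;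
**N21 is NOT discharged**; K3‴ NOT claimed; typed 28∕28, discharged count untouched; one finite four-torus programme at fixed `ε` — NOT ℝ⁴, NOT infinite volume, NOT OS,
NOT a mass gap, NOT Clay.  No decl below carries a cite tag.
-/

set_option autoImplicit false

noncomputable section

open scoped BigOperators ENNReal
open MeasureTheory Set

namespace Summit.QuantumFields.YangMills.Theorems.N21AtSRec13Selected

open Literature.MathematicalPhysics.QuantumFieldTheory.Balaban1983to89
open Literature.MathematicalPhysics.QuantumFieldTheory.Balaban1983to89.T4Continuum (T4Family ULoop)
open Literature.MathematicalPhysics.QuantumFieldTheory.Balaban1983to89.T4ShellMeasure (SlotAntiConcentration)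
open T4IndicatorShell (ShellWeightBound)
open T4ShellMeasureLevels (LevelLedger LiveWindow)
open Summit.QuantumFields.BalabanUV.T4Continuum.Spine
open Summit.QuantumFields.BalabanUV.T4Continuum.ShellMeasureRootCompositionHistories (histWeight histShell histPiece partialLaw)
open YMDAG.UVSplit
open Node00 (Stage13Params datumOfRecord₁₃)
open N21SelectedThresholds (levelLedger_of_goodAssignment levelConst_le)
open N21SelectedThresholdsTransport (pushes_of_sandwich)
open N21SelectedThresholdsTransportLedgers (lossPair_of_ne)
open N21SelectedThresholdsHistories (levelLedger_histories_of_goodAssignment)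
open N21AtSRec13Weight (exists_reweight_s_N21_sRec₁₃)

variable {N : ℕ} [NeZero N] (cr : SpineReading₁₃ N)

/-! ## §1 SHARP letters (module 19's ₁₃ twin) -/

section Sharp

variable
  (hsel : ∀ (F : T4Family) (θ : Stage13Params F N) (hP : θ.Provisos₁₃ F N), θ.Admissible F N → ∀ (g₀ : ℕ → ℝ) (os : List (ULoop F)),
      ∃ (σ : Type) (_dσ : DecidableEq σ) (X : ℕ → σ → Type) (_m : ∀ K s, MeasurableSpace (X K s))
        (SA SB : ℕ → Finset σ) (lvl : ℕ → σ → ℕ)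
        (ν : ∀ K : ℕ, (ℕ → ℝ) → ∀ s : σ, Measure (X K s)) (_f : ∀ K a s, IsFiniteMeasure (ν K a s))
        (w : ∀ (K : ℕ) (s : σ), X K s → ℝ) (θw κ ρ : ℕ → ℝ) (Fbar : ℝ) (D' : ℕ → ℝ)
        (A shA B shB : ℕ → (ℕ → ℝ) → ℝ → (cr F θ hP g₀ os).ι → ℝ) (pieceA pieceB : ℕ → (ℕ → ℝ) → ℝ → σ → (cr F θ hP g₀ os).ι → ℝ) (M₁ M₂ : ℝ)
        (N₁ : ℕ) (νbar κmin c₁ ϑ : ℝ) (a : ℕ → ℕ → ℝ),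
        -- signs, windows, widths, the level constant
        (∀ j, 0 ≤ ρ j) ∧ 0 ≤ M₁ ∧ 0 < M₂ ∧ (∀ j, D' j = Fbar / ((1 - ρ j) * κ j)) ∧ 0 ≤ Fbar ∧
        0 < κmin ∧ (∀ j, κmin ≤ κ j) ∧ (∀ j, ρ j ≤ 1 / 2) ∧
        -- the admissible assignment and its selection certificate (both runs' slots)
        (∀ K j, a K j ∈ Icc ((1 - κ j) * θw j) (θw j)) ∧
        (∀ K, ∀ s ∈ SA K ∪ SB K, SlotAntiConcentration (ν K (a K) s) (w K s) (a K (lvl K s)) (ρ (lvl K s)) (D' (lvl K s))) ∧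
        -- the carriers ARE the sharp object read at `a`
        ((cr F θ hP g₀ os).A = fun K => A K (a K)) ∧ ((cr F θ hP g₀ os).shA = fun K => shA K (a K)) ∧
        ((cr F θ hP g₀ os).B = fun K => B K (a K)) ∧ ((cr F θ hP g₀ os).shB = fun K => shB K (a K)) ∧
        -- run A at `a`: (R) and the two pushes
        (∀ K t, |t| ≤ (cr F θ hP g₀ os).l₀ → ∀ τ ∈ (cr F θ hP g₀ os).T K, 0 ≤ shA K (a K) t τ ∧ shA K (a K) t τ ≤ A K (a K) t τ ∧
          shA K (a K) t τ ≤ ∑ s ∈ SA K, pieceA K (a K) t s τ) ∧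
        (∀ K t, |t| ≤ (cr F θ hP g₀ os).l₀ → ∀ s ∈ SA K, ∑ τ ∈ (cr F θ hP g₀ os).T K, pieceA K (a K) t s τ ≤
          M₁ * (ν K (a K) s {x | a K (lvl K s) * (1 - ρ (lvl K s)) ≤ w K s x ∧ w K s x < a K (lvl K s)}).toReal) ∧
        (∀ K t, |t| ≤ (cr F θ hP g₀ os).l₀ → ∀ s ∈ SA K, M₂ * (ν K (a K) s univ).toReal ≤ ∑ τ ∈ (cr F θ hP g₀ os).T K, A K (a K) t τ) ∧
        -- run B at `a`
        (∀ K t, |t| ≤ (cr F θ hP g₀ os).l₀ → ∀ τ ∈ (cr F θ hP g₀ os).T K, 0 ≤ shB K (a K) t τ ∧ shB K (a K) t τ ≤ B K (a K) t τ ∧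
          shB K (a K) t τ ≤ ∑ s ∈ SB K, pieceB K (a K) t s τ) ∧
        (∀ K t, |t| ≤ (cr F θ hP g₀ os).l₀ → ∀ s ∈ SB K, ∑ τ ∈ (cr F θ hP g₀ os).T K, pieceB K (a K) t s τ ≤
          M₁ * (ν K (a K) s {x | a K (lvl K s) * (1 - ρ (lvl K s)) ≤ w K s x ∧ w K s x < a K (lvl K s)}).toReal) ∧
        (∀ K t, |t| ≤ (cr F θ hP g₀ os).l₀ → ∀ s ∈ SB K, M₂ * (ν K (a K) s univ).toReal ≤ ∑ τ ∈ (cr F θ hP g₀ os).T K, B K (a K) t τ) ∧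
        -- windows (N20), rate (N16)
        LiveWindow SA lvl N₁ νbar ∧ LiveWindow SB lvl N₁ νbar ∧ 0 < ϑ ∧ ϑ < 1 ∧ 0 ≤ c₁ ∧ (∀ j, ρ j ≤ c₁ * ϑ ^ j))

include hsel

/-- **THE ₁₃ K5 FACE OF N21 ON THE SELECTION ROAD, SHARP LETTERS — BOTH LEVEL LEDGERS AT THE CARRIERS AND A GEOMETRIC SHELL WEIGHT, AT EVERY ADMISSIBLE STAGE-13 TUPLE.**
Module 19's `levelLedgers_shellWeightBound_keyed₁₂_of_selectedSharp` with `Stage12 ↦ Stage13` (director-ym №125; KEY TABLE WORDS-133).  For a Stage-13 spine reading `cr`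
whose carriers are, at every admissible tuple with provisos and every `(g₀, os)`, a threshold-parametric sharp object read at a selected admissible assignment with its
certificate (`hsel`; NO clause on the weight slot): the carriers carry road I's two `LevelLedger`s ((M1) PROVED at the selected thresholds, 18b's
`levelLedger_of_goodAssignment` ×2) AND `ShellWeightBound (cr F θ hP g₀ os) … (K ↦ C·ϑ^K)`, `0 < ϑ < 1`, `0 ≤ C` (n21-a's `n21_knit_levels_geometric`).  CONDITIONAL on
every displayed binder; NE7c NOT proved; N21 NOT discharged. [bookkeeping] -/
theorem levelLedgers_shellWeightBound_keyed₁₃_of_selectedSharp (F : T4Family) (θ : Stage13Params F N) (hP : θ.Provisos₁₃ F N) (hθ : θ.Admissible F N)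
    (g₀ : ℕ → ℝ) (os : List (ULoop F)) :
    ∃ (σ : Type) (SA SB : ℕ → Finset σ) (lvl : ℕ → σ → ℕ) (pieceA pieceB : ℕ → ℝ → σ → (cr F θ hP g₀ os).ι → ℝ) (D ρ : ℕ → ℝ) (ϑ C : ℝ),
      LevelLedger (cr F θ hP g₀ os).l₀ (cr F θ hP g₀ os).T (cr F θ hP g₀ os).A (cr F θ hP g₀ os).shA SA pieceA lvl D ρ ∧
      LevelLedger (cr F θ hP g₀ os).l₀ (cr F θ hP g₀ os).T (cr F θ hP g₀ os).B (cr F θ hP g₀ os).shB SB pieceB lvl D ρ ∧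
      0 < ϑ ∧ ϑ < 1 ∧ 0 ≤ C ∧ ShellWeightBound (cr F θ hP g₀ os).l₀ (cr F θ hP g₀ os).T (cr F θ hP g₀ os).A (cr F θ hP g₀ os).B
        (cr F θ hP g₀ os).shA (cr F θ hP g₀ os).shB fun K => C * ϑ ^ K := by
  obtain ⟨σ, _dσ, X, _m, SA, SB, lvl, ν, _f, w, θw, κ, ρ, Fbar, D', A, shA, B, shB, pieceA, pieceB, M₁, M₂, N₁, νbar, κmin, c₁, ϑ, a,
    hρ0, hM₁, hM₂, hD', hFbar, hκmin, hκminle, hρhalf, _hadm, hgood, hSA, hSshA, hSB, hSshB, hRA, hpushA, htotalA, hRB, hpushB, htotalB,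
    hwinA, hwinB, hϑ0, hϑ1, hc₁, hrate⟩ := hsel F θ hP hθ g₀ os
  have hD'0 : ∀ j, 0 ≤ D' j := fun j => by
    rw [hD' j]
    have h1 : 0 < 1 - ρ j := by linarith [hρhalf j]
    have h2 : 0 < κ j := lt_of_lt_of_le hκmin (hκminle j)
    positivity
  have hLA := levelLedger_of_goodAssignment (l₀ := (cr F θ hP g₀ os).l₀) (T := (cr F θ hP g₀ os).T) a
    (fun K s hs => hgood K s (Finset.mem_union_left _ hs)) hD'0 hρ0 hM₁ hM₂
    (fun K t ht τ hτ => (hRA K t ht τ hτ).1) (fun K t ht τ hτ => (hRA K t ht τ hτ).2.1) (fun K t ht τ hτ => (hRA K t ht τ hτ).2.2)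
    hpushA htotalA
  have hLB := levelLedger_of_goodAssignment (l₀ := (cr F θ hP g₀ os).l₀) (T := (cr F θ hP g₀ os).T) a
    (fun K s hs => hgood K s (Finset.mem_union_right _ hs)) hD'0 hρ0 hM₁ hM₂
    (fun K t ht τ hτ => (hRB K t ht τ hτ).1) (fun K t ht τ hτ => (hRB K t ht τ hτ).2.1) (fun K t ht τ hτ => (hRB K t ht τ hτ).2.2)
    hpushB htotalB
  have hD : ∀ j, M₁ / M₂ * D' j ≤ M₁ / M₂ * (2 * Fbar / κmin) := fun j => by
    rw [hD' j]
    exact mul_le_mul_of_nonneg_left (levelConst_le hFbar (hρhalf j) hκmin (hκminle j)) (div_nonneg hM₁ hM₂.le)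
  have hν : 0 ≤ νbar := hwinA.νbar_nonneg
  have hSW := n21_knit_levels_geometric hLA hLB hwinA hwinB hD hD hϑ0 hϑ1 hrate hrate
  have hC : 0 ≤ 2 * ((N₁ + 1) * νbar * (M₁ / M₂ * (2 * Fbar / κmin)) * c₁ * ϑ⁻¹ ^ N₁) := by
    have : 0 ≤ M₁ / M₂ * (2 * Fbar / κmin) := by positivity
    positivity
  rw [hSA, hSshA, hSB, hSshB]
  exact ⟨σ, SA, SB, lvl, _, _, _, ρ, ϑ, _, hLA, hLB, hϑ0, hϑ1, hC, hSW⟩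

/-- **… HENCE SOME RE-WEIGHTING OF THE READING CARRIES THE K5 STUB `S_N21 (SRec₁₃ ·)`** (21a's `exists_reweight_s_N21_sRec₁₃`; re-weighting is invisible to N20 ∕ N27x ∕ N19,
21a §2). [bookkeeping] -/
theorem exists_reweight_s_N21_sRec₁₃_of_selectedSharp :
    ∃ w : (F : T4Family) → (θ : Stage13Params F N) → θ.Provisos₁₃ F N → (ℕ → ℝ) → List (ULoop F) → ℕ → ℝ,
      S_N21 (SRec₁₃ fun F θ hP g₀ os => { cr F θ hP g₀ os with Wsh := w F θ hP g₀ os }) :=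
  exists_reweight_s_N21_sRec₁₃ cr fun F θ hP hθ g₀ os => by
    obtain ⟨_, _, _, _, _, _, _, _, _, _, _, _, _, _, _, hSW⟩ := levelLedgers_shellWeightBound_keyed₁₃_of_selectedSharp cr hsel F θ hP hθ g₀ os
    exact ⟨_, hSW⟩

end Sharp

/-! ## §2 TRANSPORTED masses (lens ROW A‴; module 20c's package at the selected assignment) -/

section Transport

variable
  (htr : ∀ (F : T4Family) (θ : Stage13Params F N) (hP : θ.Provisos₁₃ F N), θ.Admissible F N → ∀ (g₀ : ℕ → ℝ) (os : List (ULoop F)),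
      ∃ (σ : Type) (_dσ : DecidableEq σ) (X : ℕ → σ → Type) (_m : ∀ K s, MeasurableSpace (X K s))
        (SA SB : ℕ → Finset σ) (lvl : ℕ → σ → ℕ)
        (ν₀ : ∀ K : ℕ, ∀ s : σ, Measure (X K s)) (_f₀ : ∀ K s, IsFiniteMeasure (ν₀ K s))
        (νt : ∀ K : ℕ, ℝ → ∀ s : σ, Measure (X K s)) (_ft : ∀ K t s, IsFiniteMeasure (νt K t s))
        (w : ∀ (K : ℕ) (s : σ), X K s → ℝ) (θw κ ρ : ℕ → ℝ) (Fbar : ℝ) (D' : ℕ → ℝ) (C : ℝ≥0∞)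
        (A' B' : ℕ → ℝ → (cr F θ hP g₀ os).ι → ℝ≥0∞) (mA mB : ℕ → ℝ → σ → (cr F θ hP g₀ os).ι → ℝ≥0∞)
        (N₁ : ℕ) (νbar κmin c₁ ϑ : ℝ) (a : ℕ → ℕ → ℝ),
        -- signs, windows, widths, the level constant, the sandwich constant
        (∀ j, 0 ≤ ρ j) ∧ (∀ j, D' j = Fbar / ((1 - ρ j) * κ j)) ∧ 0 ≤ Fbar ∧ 0 < κmin ∧ (∀ j, κmin ≤ κ j) ∧ (∀ j, ρ j ≤ 1 / 2) ∧
        C ≠ ⊤ ∧ C ≠ 0 ∧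
        -- the admissible assignment and its selection certificate (both runs' slots) for the state laws
        (∀ K j, a K j ∈ Icc ((1 - κ j) * θw j) (θw j)) ∧
        (∀ K, ∀ s ∈ SA K ∪ SB K, SlotAntiConcentration (ν₀ K s) (w K s) (a K (lvl K s)) (ρ (lvl K s)) (D' (lvl K s))) ∧
        -- the carriers ARE the transported masses read at `a`
        ((cr F θ hP g₀ os).A = fun K t τ => (A' K t τ).toReal) ∧ ((cr F θ hP g₀ os).B = fun K t τ => (B' K t τ).toReal) ∧
        -- the sandwich at every live slot
        (∀ K t, |t| ≤ (cr F θ hP g₀ os).l₀ → ∀ s ∈ SA K ∪ SB K, νt K t s ≤ C • ν₀ K s ∧ ν₀ K s ≤ C • νt K t s) ∧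
        -- run A: (R), transported pieces and totals
        (∀ K t, |t| ≤ (cr F θ hP g₀ os).l₀ → ∀ τ ∈ (cr F θ hP g₀ os).T K, 0 ≤ (cr F θ hP g₀ os).shA K t τ ∧
          (cr F θ hP g₀ os).shA K t τ ≤ (A' K t τ).toReal ∧ (cr F θ hP g₀ os).shA K t τ ≤ ∑ s ∈ SA K, (mA K t s τ).toReal) ∧
        (∀ K t, |t| ≤ (cr F θ hP g₀ os).l₀ → ∀ s ∈ SA K,
          ∑ τ ∈ (cr F θ hP g₀ os).T K, mA K t s τ ≤ νt K t s {x | a K (lvl K s) * (1 - ρ (lvl K s)) ≤ w K s x ∧ w K s x < a K (lvl K s)}) ∧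
        (∀ K t, |t| ≤ (cr F θ hP g₀ os).l₀ → ∀ s ∈ SA K, ∑ τ ∈ (cr F θ hP g₀ os).T K, A' K t τ = νt K t s univ) ∧
        -- run B
        (∀ K t, |t| ≤ (cr F θ hP g₀ os).l₀ → ∀ τ ∈ (cr F θ hP g₀ os).T K, 0 ≤ (cr F θ hP g₀ os).shB K t τ ∧
          (cr F θ hP g₀ os).shB K t τ ≤ (B' K t τ).toReal ∧ (cr F θ hP g₀ os).shB K t τ ≤ ∑ s ∈ SB K, (mB K t s τ).toReal) ∧
        (∀ K t, |t| ≤ (cr F θ hP g₀ os).l₀ → ∀ s ∈ SB K,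
          ∑ τ ∈ (cr F θ hP g₀ os).T K, mB K t s τ ≤ νt K t s {x | a K (lvl K s) * (1 - ρ (lvl K s)) ≤ w K s x ∧ w K s x < a K (lvl K s)}) ∧
        (∀ K t, |t| ≤ (cr F θ hP g₀ os).l₀ → ∀ s ∈ SB K, ∑ τ ∈ (cr F θ hP g₀ os).T K, B' K t τ = νt K t s univ) ∧
        -- windows (N20), rate (N16)
        LiveWindow SA lvl N₁ νbar ∧ LiveWindow SB lvl N₁ νbar ∧ 0 < ϑ ∧ ϑ < 1 ∧ 0 ≤ c₁ ∧ (∀ j, ρ j ≤ c₁ * ϑ ^ j))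

include htr

/-- **THE ₁₃ K5 FACE OF N21 ON THE SELECTION ROAD, TRANSPORTED MASSES.**  For a Stage-13 spine reading `cr` whose term weights ARE, at every admissible tuple, the `toReal`s of
transported `ℝ≥0∞` masses read at a selected admissible assignment (lens ROW A‴ lineage data: `t`-free finite state laws `ν₀`, tilted twins `νt`, ONE sandwich constant
`C ≠ 0, ⊤`, `hpieceT`, `htotT`, the (R) facts of its shell letters, the selection certificate for `(ν₀, w)`): `ShellWeightBound (cr F θ hP g₀ os) … (K ↦ C′·ϑ^K)` with
`0 < ϑ < 1`, `0 ≤ C′` — 18b's `levelLedger_of_goodAssignment` ×2 with the pushes from 20b's `pushes_of_sandwich`, then n21-a's `n21_knit_levels_geometric`.  CONDITIONAL on every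
displayed binder; NE7c NOT proved; N21 NOT discharged. [bookkeeping] -/
theorem shellWeightBound_keyed₁₃_of_selectedTransport (F : T4Family) (θ : Stage13Params F N) (hP : θ.Provisos₁₃ F N) (hθ : θ.Admissible F N)
    (g₀ : ℕ → ℝ) (os : List (ULoop F)) :
    ∃ ϑ C' : ℝ, 0 < ϑ ∧ ϑ < 1 ∧ 0 ≤ C' ∧ ShellWeightBound (cr F θ hP g₀ os).l₀ (cr F θ hP g₀ os).T (cr F θ hP g₀ os).A (cr F θ hP g₀ os).B
      (cr F θ hP g₀ os).shA (cr F θ hP g₀ os).shB fun K => C' * ϑ ^ K := by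
  obtain ⟨σ, _dσ, X, _m, SA, SB, lvl, ν₀, _f₀, νt, _ft, w, θw, κ, ρ, Fbar, D', C, A', B', mA, mB, N₁, νbar, κmin, c₁, ϑ, a,
    hρ0, hD', hFbar, hκmin, hκminle, hρhalf, hC, hC0, _hadm, hgood, hSA, hSB, hsand, hRA, hpieceTA, htotTA, hRB, hpieceTB, htotTB,
    hwinA, hwinB, hϑ0, hϑ1, hc₁, hrate⟩ := htr F θ hP hθ g₀ os
  obtain ⟨hM₁, hM₂⟩ := lossPair_of_ne C hC hC0
  have hD'0 : ∀ j, 0 ≤ D' j := fun j => by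
    rw [hD' j]
    have h1 : 0 < 1 - ρ j := by linarith [hρhalf j]
    have h2 : 0 < κ j := lt_of_lt_of_le hκmin (hκminle j)
    positivity
  have hLA := levelLedger_of_goodAssignment (X := X) (ν := fun K _ s => ν₀ K s) (w := w) (lvl := lvl) (ρ := ρ) (l₀ := (cr F θ hP g₀ os).l₀)
    (T := (cr F θ hP g₀ os).T) (S := SA) (A := fun K _ t τ => (A' K t τ).toReal) (sh := fun K _ t τ => (cr F θ hP g₀ os).shA K t τ)
    (piece := fun K _ t s τ => (mA K t s τ).toReal) (M₁ := C.toReal) (M₂ := C⁻¹.toReal) (D' := D') a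
    (fun K s hs => hgood K s (Finset.mem_union_left _ hs)) hD'0 hρ0 hM₁ hM₂
    (fun K t ht τ hτ => (hRA K t ht τ hτ).1) (fun K t ht τ hτ => (hRA K t ht τ hτ).2.1) (fun K t ht τ hτ => (hRA K t ht τ hτ).2.2)
    (fun K t ht s hs =>
      (pushes_of_sandwich ((cr F θ hP g₀ os).T K) (ν₀ K s) (νt K t s) hC hC0 (hsand K t ht s (Finset.mem_union_left _ hs)).1
        (hsand K t ht s (Finset.mem_union_left _ hs)).2 (mA K t s) (A' K t) _ (hpieceTA K t ht s hs) (htotTA K t ht s hs)).1)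
    (fun K t ht s hs =>
      (pushes_of_sandwich ((cr F θ hP g₀ os).T K) (ν₀ K s) (νt K t s) hC hC0 (hsand K t ht s (Finset.mem_union_left _ hs)).1
        (hsand K t ht s (Finset.mem_union_left _ hs)).2 (mA K t s) (A' K t) _ (hpieceTA K t ht s hs) (htotTA K t ht s hs)).2)
  have hLB := levelLedger_of_goodAssignment (X := X) (ν := fun K _ s => ν₀ K s) (w := w) (lvl := lvl) (ρ := ρ) (l₀ := (cr F θ hP g₀ os).l₀)
    (T := (cr F θ hP g₀ os).T) (S := SB) (A := fun K _ t τ => (B' K t τ).toReal) (sh := fun K _ t τ => (cr F θ hP g₀ os).shB K t τ)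
    (piece := fun K _ t s τ => (mB K t s τ).toReal) (M₁ := C.toReal) (M₂ := C⁻¹.toReal) (D' := D') a
    (fun K s hs => hgood K s (Finset.mem_union_right _ hs)) hD'0 hρ0 hM₁ hM₂
    (fun K t ht τ hτ => (hRB K t ht τ hτ).1) (fun K t ht τ hτ => (hRB K t ht τ hτ).2.1) (fun K t ht τ hτ => (hRB K t ht τ hτ).2.2)
    (fun K t ht s hs =>
      (pushes_of_sandwich ((cr F θ hP g₀ os).T K) (ν₀ K s) (νt K t s) hC hC0 (hsand K t ht s (Finset.mem_union_right _ hs)).1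
        (hsand K t ht s (Finset.mem_union_right _ hs)).2 (mB K t s) (B' K t) _ (hpieceTB K t ht s hs) (htotTB K t ht s hs)).1)
    (fun K t ht s hs =>
      (pushes_of_sandwich ((cr F θ hP g₀ os).T K) (ν₀ K s) (νt K t s) hC hC0 (hsand K t ht s (Finset.mem_union_right _ hs)).1
        (hsand K t ht s (Finset.mem_union_right _ hs)).2 (mB K t s) (B' K t) _ (hpieceTB K t ht s hs) (htotTB K t ht s hs)).2)
  have hD : ∀ j, C.toReal / C⁻¹.toReal * D' j ≤ C.toReal / C⁻¹.toReal * (2 * Fbar / κmin) := fun j => by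
    rw [hD' j]
    exact mul_le_mul_of_nonneg_left (levelConst_le hFbar (hρhalf j) hκmin (hκminle j)) (div_nonneg hM₁ hM₂.le)
  have hν : 0 ≤ νbar := hwinA.νbar_nonneg
  have hSW := n21_knit_levels_geometric hLA hLB hwinA hwinB hD hD hϑ0 hϑ1 hrate hrate
  have hC' : 0 ≤ 2 * ((N₁ + 1) * νbar * (C.toReal / C⁻¹.toReal * (2 * Fbar / κmin)) * c₁ * ϑ⁻¹ ^ N₁) := by
    have : 0 ≤ C.toReal / C⁻¹.toReal * (2 * Fbar / κmin) := by positivity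
    positivity
  rw [hSA, hSB]
  exact ⟨ϑ, _, hϑ0, hϑ1, hC', hSW⟩

/-- **… HENCE SOME RE-WEIGHTING OF THE READING CARRIES `S_N21 (SRec₁₃ ·)`** (21a §3). [bookkeeping] -/
theorem exists_reweight_s_N21_sRec₁₃_of_selectedTransport :
    ∃ w : (F : T4Family) → (θ : Stage13Params F N) → θ.Provisos₁₃ F N → (ℕ → ℝ) → List (ULoop F) → ℕ → ℝ,
      S_N21 (SRec₁₃ fun F θ hP g₀ os => { cr F θ hP g₀ os with Wsh := w F θ hP g₀ os }) :=
  exists_reweight_s_N21_sRec₁₃ cr fun F θ hP hθ g₀ os => by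
    obtain ⟨_, _, _, _, _, hSW⟩ := shellWeightBound_keyed₁₃_of_selectedTransport cr htr F θ hP hθ g₀ os
    exact ⟨_, hSW⟩

end Transport

/-! ## §3 HISTORY letters (module 20's package at the selected assignment) -/

section Histories

variable
  (hhist : ∀ (F : T4Family) (θ : Stage13Params F N) (hP : θ.Provisos₁₃ F N), θ.Admissible F N → ∀ (g₀ : ℕ → ℝ) (os : List (ULoop F)),
      ∃ (Ω : ℕ → Type) (_mΩ : ∀ K, MeasurableSpace (Ω K)) (σ : Type) (_dσ : DecidableEq σ)
        (C : ℕ → Finset σ) (small : ℕ → (cr F θ hP g₀ os).ι → Finset σ) (lvl : ℕ → σ → ℕ)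
        (νA νB : ∀ K : ℕ, (ℕ → ℝ) → ℝ → (cr F θ hP g₀ os).ι → Measure (Ω K))
        (_fA : ∀ K a t τ, IsFiniteMeasure (νA K a t τ)) (_fB : ∀ K a t τ, IsFiniteMeasure (νB K a t τ))
        (lawA lawB : ∀ K : ℕ, (ℕ → ℝ) → σ → Measure (Ω K))
        (_gA : ∀ K a s, IsFiniteMeasure (lawA K a s)) (_gB : ∀ K a s, IsFiniteMeasure (lawB K a s))
        (uA uB : ∀ K : ℕ, σ → Ω K → ℝ) (κ ρ : ℕ → ℝ) (M₁ M₂ : ℝ) (N₁ : ℕ) (νbar κmin c₁ ϑ : ℝ) (a : ℕ → ℕ → ℝ),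
        -- measurability, live small regions, signs, windows, the losses
        (∀ K s, Measurable (uA K s)) ∧ (∀ K s, Measurable (uB K s)) ∧ (∀ K, ∀ τ ∈ (cr F θ hP g₀ os).T K, small K τ ⊆ C K) ∧
        (∀ j, 0 ≤ ρ j ∧ ρ j < 1) ∧ (∀ j, 0 < κ j) ∧ 0 < κmin ∧ (∀ j, κmin ≤ κ j) ∧ (∀ j, ρ j ≤ 1 / 2) ∧ 0 ≤ M₁ ∧ 0 < M₂ ∧
        -- the selection certificate AT `a` for both runs' envelope laws
        (∀ K, ∀ s ∈ C K, SlotAntiConcentration (lawA K (a K) s) (uA K s) (a K (lvl K s)) (ρ (lvl K s)) (2 * νbar / ((1 - ρ (lvl K s)) * κ (lvl K s)))) ∧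
        (∀ K, ∀ s ∈ C K, SlotAntiConcentration (lawB K (a K) s) (uB K s) (a K (lvl K s)) (ρ (lvl K s)) (2 * νbar / ((1 - ρ (lvl K s)) * κ (lvl K s)))) ∧
        -- the carriers ARE the history letters at `a`
        ((cr F θ hP g₀ os).A = fun K t τ => histWeight (νA K (a K) t τ) (small K τ) (uA K) fun s => a K (lvl K s)) ∧
        ((cr F θ hP g₀ os).shA = fun K t τ => histShell (νA K (a K) t τ) (small K τ) (uA K) (uB K) fun s => a K (lvl K s)) ∧
        ((cr F θ hP g₀ os).B = fun K t τ => histWeight (νB K (a K) t τ) (small K τ) (uB K) fun s => a K (lvl K s)) ∧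
        ((cr F θ hP g₀ os).shB = fun K t τ => histShell (νB K (a K) t τ) (small K τ) (uB K) (uA K) fun s => a K (lvl K s)) ∧
        -- a.e. closeness AT `a` (N16 by level), envelopes and mass controls AT `a`
        (∀ K t, |t| ≤ (cr F θ hP g₀ os).l₀ → ∀ τ ∈ (cr F θ hP g₀ os).T K, ∀ s ∈ small K τ,
          ∀ᵐ ω ∂(νA K (a K) t τ), |uA K s ω - uB K s ω| ≤ ρ (lvl K s) * a K (lvl K s)) ∧
        (∀ K t, |t| ≤ (cr F θ hP g₀ os).l₀ → ∀ τ ∈ (cr F θ hP g₀ os).T K, ∀ s ∈ small K τ,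
          ∀ᵐ ω ∂(νB K (a K) t τ), |uB K s ω - uA K s ω| ≤ ρ (lvl K s) * a K (lvl K s)) ∧
        (∀ K t, |t| ≤ (cr F θ hP g₀ os).l₀ → ∀ s ∈ C K,
          partialLaw ((cr F θ hP g₀ os).T K) (νA K (a K) t) (small K) (uA K) (fun s => a K (lvl K s)) s ≤ ENNReal.ofReal M₁ • lawA K (a K) s) ∧
        (∀ K t, |t| ≤ (cr F θ hP g₀ os).l₀ → ∀ s ∈ C K,
          partialLaw ((cr F θ hP g₀ os).T K) (νB K (a K) t) (small K) (uB K) (fun s => a K (lvl K s)) s ≤ ENNReal.ofReal M₁ • lawB K (a K) s) ∧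
        (∀ K t, |t| ≤ (cr F θ hP g₀ os).l₀ → ∀ s ∈ C K, M₂ * (lawA K (a K) s univ).toReal ≤
          ∑ τ ∈ (cr F θ hP g₀ os).T K, histWeight (νA K (a K) t τ) (small K τ) (uA K) fun s => a K (lvl K s)) ∧
        (∀ K t, |t| ≤ (cr F θ hP g₀ os).l₀ → ∀ s ∈ C K, M₂ * (lawB K (a K) s univ).toReal ≤
          ∑ τ ∈ (cr F θ hP g₀ os).T K, histWeight (νB K (a K) t τ) (small K τ) (uB K) fun s => a K (lvl K s)) ∧
        -- window (N20), rate (N16)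
        LiveWindow C lvl N₁ νbar ∧ 0 < ϑ ∧ ϑ < 1 ∧ 0 ≤ c₁ ∧ (∀ j, ρ j ≤ c₁ * ϑ ^ j))

include hhist

/-- **THE ₁₃ K5 FACE OF N21 ON THE SELECTION ROAD, HISTORY LETTERS.**  For a Stage-13 spine reading `cr` whose carriers ARE, at every admissible tuple, the history letters
(`histWeight` ∕ `histShell`) of two threshold-parametric history families read at a selected admissible assignment `a`, handed with module 20's package AT `a` (measurability,
live small regions inside the live slots `C K`, the selection certificate for the envelope laws, a.e. closeness `ρ_{lvl s}·a K (lvl s)` under each run's weights, the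
envelopes `partialLaw ≤ M₁ • law`, the mass controls, N20's window, N16's rate): `ShellWeightBound (cr F θ hP g₀ os) … (K ↦ C′·ϑ^K)`, `0 < ϑ < 1`, `0 ≤ C′` — module 20's
`levelLedger_histories_of_goodAssignment` ×2 ((R) and pushes PROVED there) + n21-a's `n21_knit_levels_geometric`.  CONDITIONAL on every displayed binder; NE7c NOT proved;
N21 NOT discharged. [bookkeeping] -/
theorem shellWeightBound_keyed₁₃_of_selectedHistories (F : T4Family) (θ : Stage13Params F N) (hP : θ.Provisos₁₃ F N) (hθ : θ.Admissible F N)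
    (g₀ : ℕ → ℝ) (os : List (ULoop F)) :
    ∃ ϑ C' : ℝ, 0 < ϑ ∧ ϑ < 1 ∧ 0 ≤ C' ∧ ShellWeightBound (cr F θ hP g₀ os).l₀ (cr F θ hP g₀ os).T (cr F θ hP g₀ os).A (cr F θ hP g₀ os).B
      (cr F θ hP g₀ os).shA (cr F θ hP g₀ os).shB fun K => C' * ϑ ^ K := by
  obtain ⟨Ω, _mΩ, σ, _dσ, C, small, lvl, νA, νB, _fA, _fB, lawA, lawB, _gA, _gB, uA, uB, κ, ρ, M₁, M₂, N₁, νbar, κmin, c₁, ϑ, a,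
    huA, huB, hsmall, hρ, hκ, hκmin, hκminle, hρhalf, hM₁, hM₂, hgoodA, hgoodB, hSA, hSshA, hSB, hSshB, hcloseA, hcloseB, henvA, henvB, hmassA, hmassB,
    hwin, hϑ0, hϑ1, hc₁, hrate⟩ := hhist F θ hP hθ g₀ os
  have hνbar : 0 ≤ νbar := hwin.νbar_nonneg
  have hD' : ∀ j, 0 ≤ 2 * νbar / ((1 - ρ j) * κ j) := fun j => by
    have h1 : 0 < 1 - ρ j := by linarith [(hρ j).2]
    have h2 := hκ j
    positivity
  have hLA := levelLedger_histories_of_goodAssignment (T := (cr F θ hP g₀ os).T) (l₀ := (cr F θ hP g₀ os).l₀) (ν := νA) (law := lawA) (u := uA) (v := uB)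
    (D' := fun j => 2 * νbar / ((1 - ρ j) * κ j)) a huA huB hsmall hgoodA hD' (fun j => (hρ j).1) hM₁ hM₂ hcloseA henvA hmassA
  have hLB := levelLedger_histories_of_goodAssignment (T := (cr F θ hP g₀ os).T) (l₀ := (cr F θ hP g₀ os).l₀) (ν := νB) (law := lawB) (u := uB) (v := uA)
    (D' := fun j => 2 * νbar / ((1 - ρ j) * κ j)) a huB huA hsmall hgoodB hD' (fun j => (hρ j).1) hM₁ hM₂ hcloseB henvB hmassB
  have hF : 0 ≤ 2 * νbar := by positivity
  have hD : ∀ j, M₁ / M₂ * (2 * νbar / ((1 - ρ j) * κ j)) ≤ M₁ / M₂ * (2 * (2 * νbar) / κmin) := fun j =>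
    mul_le_mul_of_nonneg_left (levelConst_le hF (hρhalf j) hκmin (hκminle j)) (div_nonneg hM₁ hM₂.le)
  have hSW := n21_knit_levels_geometric hLA hLB hwin hwin hD hD hϑ0 hϑ1 hrate hrate
  have hC' : 0 ≤ 2 * ((N₁ + 1) * νbar * (M₁ / M₂ * (2 * (2 * νbar) / κmin)) * c₁ * ϑ⁻¹ ^ N₁) := by
    have : 0 ≤ M₁ / M₂ * (2 * (2 * νbar) / κmin) := by positivity
    positivity
  rw [hSA, hSshA, hSB, hSshB]
  exact ⟨ϑ, _, hϑ0, hϑ1, hC', hSW⟩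

/-- **… HENCE SOME RE-WEIGHTING OF THE READING CARRIES `S_N21 (SRec₁₃ ·)`** (21a §3). [bookkeeping] -/
theorem exists_reweight_s_N21_sRec₁₃_of_selectedHistories :
    ∃ w : (F : T4Family) → (θ : Stage13Params F N) → θ.Provisos₁₃ F N → (ℕ → ℝ) → List (ULoop F) → ℕ → ℝ,
      S_N21 (SRec₁₃ fun F θ hP g₀ os => { cr F θ hP g₀ os with Wsh := w F θ hP g₀ os }) :=
  exists_reweight_s_N21_sRec₁₃ cr fun F θ hP hθ g₀ os => by
    obtain ⟨_, _, _, _, _, hSW⟩ := shellWeightBound_keyed₁₃_of_selectedHistories cr hhist F θ hP hθ g₀ os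
    exact ⟨_, hSW⟩

end Histories

end Summit.QuantumFields.YangMills.Theorems.N21AtSRec13Selected

end
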